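import Summits.QuantumFields.YangMills.Theses.FradkinShenkerFlow
import Literature.MathematicalPhysics.QuantumLattice.TorusWilsonMarkov

/-!
# Stub `stub_boxDecoupling_of_hmc` of the line `maxcorr-halving` (crux `SusceptibilityToPoincare`)

Route `FradkinShenkerFlow` of `YangMills`, crux item `stmt-QuantumFields-9441`
(`Summit.QuantumFields.YangMills.Theses.FradkinShenkerFlow.SusceptibilityToPoincare`, FS ⇒ UP).
This file proves stub (C2) of the registered skeleton `Lines/maxcorr-halving.lean`:
**(H) hierarchical maximal correlation ⟹ (B) box decoupling**, for every compact group `G`,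
lattice representation `r`, real `β` and every torus `(ℤ/(2S+1))⁴` with the Wilson measure
`μ = wilsonMeasure r.ρ β`. Notation: `P_D := μ[· | cylinderEvents D]` for a set `D` of links, a
cylinder `Q = {x | ∀ ν, (x ν - a ν).val < n ν}` with exterior links `K = {ℓ | ℓ.1 ∉ Q}`, the
offset of a link `ℓ` in direction `i` is `(ℓ.1 i - a i).val`, and the maximal-correlation bound
between link sets `X, Z ⊆ Q` given `K` is `‖P_{K∪X} P_{K∪Z} f − P_K f‖₂ ≤ ρ ‖f − P_K f‖₂` for all
bounded measurable `f` (always in squared-integral form).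

* (H) gives `R ≥ 1`, `ρ < 1` and the bound for every `R`-slab `X = {(offset − c).val < R}` and
  its far set `Z = {3R ≤ (offset − c + R).val}`, in every cylinder, conditionally on `K`.
* (B, ring) `n i = 2S+1`, `2R ≤ S`: the slabs `{(ℓ.1 i − b).val < R}` and
  `{(ℓ.1 i − b − S).val < R}` satisfy the bound with `ρ`.  This is (H) at `c := (b − a i).val`
  (`BoxDecoup.le_val_sub_add_of_antipodal`: the antipodal slab lies in the far set) and
  monotonicity of the bound under shrinking `Z` (`maxCorr_sq_le_of_mono`, tower property and
  `L²`-contractivity, with a truncation of `P_{Z'} f` to a bounded measurable version).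
* (B, corridor) `n i ≤ 2S`, `R ≤ c`: `X = {offset < c}` and `Z = {c + mR ≤ offset}` satisfy the
  bound with `ρ^{⌊m/2⌋}`.  Slabs in offset form (`BoxDecoup.val_sub_natCast_lt_iff`,
  `BoxDecoup.le_val_sub_natCast_add`: everything `2R` above an interior slab is in its far set),
  the Markov property of `μ` across a separating slab in operator form
  (`condExp_wilsonMeasure_markov_slab`, from the DLR structure of the torus Wilson state,
  `Literature/MathematicalPhysics/QuantumLattice/TorusWilsonMarkov.lean`), and the exact
  telescoping `P_{S_l} P_Z − P_K = (P_{S_l} P_{S_{l+1}} − P_K)(P_{S_{l+1}} P_Z − P_K)` on the range of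
  `P_Z` (`BoxDecoup.sq_le_of_markov_step`) along the odd slabs `S_l = [c + 2lR, c + (2l+1)R)`,
  `l < ⌊m/2⌋`, each contributing a factor `ρ` by (H); the leading `P_{K∪X}` is a contraction
  (`BoxDecoup.sq_le_of_markov_first`), and `⌊m/2⌋ = 0` or `Z = ∅` is `maxCorr_sq_le_of_coarse`.

References: F. Martinelli, *Lectures on Glauber dynamics for discrete spin models*, LNM 1717
(1999), §3; H.-O. Georgii, *Gibbs Measures and Phase Transitions* (2011), Rem. 1.24.
-/

noncomputable section

open MeasureTheory ProbabilityTheory Filter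
open Literature.MathematicalPhysics.QuantumFieldTheory
open Literature.MathematicalPhysics.QuantumLattice (integral_sq_congr_ae ae_abs_sub_le_add
  integral_condExp_sq_le_of_ae_bdd condExp_sub_condExp_of_le maxCorr_sq_le_of_coarse
  maxCorr_sq_eq_zero_of_coarse maxCorr_sq_le_of_mono condExp_wilsonMeasure_markov_slab)

namespace Summit.QuantumFields.YangMills.Theorems.SusceptibilityToPoincare

namespace BoxDecoup

/-! ### The slab chain in `L²` (abstract finite measure space) -/

section Abstract

variable {Ω : Type*} {mK mX mM mZ : MeasurableSpace Ω} {m0 : MeasurableSpace Ω}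
  {μ : Measure Ω} [IsFiniteMeasure μ]

/-- **One step of the slab chain.** If `P_X P_Z f = P_X P_M P_Z f` a.e. (Markov: `M` separates
`X` from `Z`) and `‖P_X P_M h - P_K h‖₂ ≤ ρ ‖h - P_K h‖₂` for a.e. bounded `h`, then
`‖P_X P_Z f - P_K f‖₂ ≤ ρ ‖P_M P_Z f - P_K f‖₂` (take `h := P_M P_Z f`; exact telescoping of
`(P_X P_M - P_K)(P_M P_Z - P_K)`). [folklore] -/
theorem sq_le_of_markov_step (hM : mM ≤ m0) (hZ : mZ ≤ m0)
    (hKM : mK ≤ mM) (hKZ : mK ≤ mZ) {ρ : ℝ}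
    (H : ∀ h : Ω → ℝ, AEStronglyMeasurable h μ → ∀ M : ℝ, (∀ᵐ ω ∂μ, |h ω| ≤ M) →
      ∫ ω, ((μ[μ[h|mM]|mX]) ω - (μ[h|mK]) ω) ^ 2 ∂μ ≤
        ρ ^ 2 * ∫ ω, (h ω - (μ[h|mK]) ω) ^ 2 ∂μ)
    {f : Ω → ℝ} {M : ℝ} (hb : ∀ᵐ ω ∂μ, |f ω| ≤ M)
    (hMarkov : μ[μ[f|mZ]|mX] =ᵐ[μ] μ[μ[μ[f|mZ]|mM]|mX]) :
    ∫ ω, ((μ[μ[f|mZ]|mX]) ω - (μ[f|mK]) ω) ^ 2 ∂μ ≤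
      ρ ^ 2 * ∫ ω, ((μ[μ[f|mZ]|mM]) ω - (μ[f|mK]) ω) ^ 2 ∂μ := by
  have hgb : ∀ᵐ ω ∂μ, |(μ[μ[f|mZ]|mM]) ω| ≤ M :=
    ae_bdd_abs_condExp_of_ae_bdd_abs (ae_bdd_abs_condExp_of_ae_bdd_abs hb)
  have Hg := H (μ[μ[f|mZ]|mM]) integrable_condExp.aestronglyMeasurable M hgb
  have h1 : μ[μ[μ[f|mZ]|mM]|mM] = μ[μ[f|mZ]|mM] :=
    condExp_of_stronglyMeasurable hM stronglyMeasurable_condExp integrable_condExp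
  have h2 : μ[μ[μ[f|mZ]|mM]|mK] =ᵐ[μ] μ[f|mK] :=
    (condExp_condExp_of_le hKM hM).trans (condExp_condExp_of_le hKZ hZ)
  rw [h1] at Hg
  have hL : (fun ω => (μ[μ[μ[f|mZ]|mM]|mX]) ω - (μ[μ[μ[f|mZ]|mM]|mK]) ω) =ᵐ[μ]
      fun ω => (μ[μ[f|mZ]|mX]) ω - (μ[f|mK]) ω := hMarkov.symm.sub h2
  have hR : (fun ω => (μ[μ[f|mZ]|mM]) ω - (μ[μ[μ[f|mZ]|mM]|mK]) ω) =ᵐ[μ]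
      fun ω => (μ[μ[f|mZ]|mM]) ω - (μ[f|mK]) ω := EventuallyEq.rfl.sub h2
  rwa [integral_sq_congr_ae hL, integral_sq_congr_ae hR] at Hg

/-- **First step of the slab chain.** If `P_X P_Z f = P_X P_M P_Z f` a.e. and `mK ≤ mX`, then
`‖P_X P_Z f - P_K f‖₂ ≤ ‖P_M P_Z f - P_K f‖₂` (`P_X` is a contraction and fixes `P_K f`).
[folklore] -/
theorem sq_le_of_markov_first (hX : mX ≤ m0) (hKX : mK ≤ mX) {f : Ω → ℝ} {M : ℝ}
    (hb : ∀ᵐ ω ∂μ, |f ω| ≤ M)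
    (hMarkov : μ[μ[f|mZ]|mX] =ᵐ[μ] μ[μ[μ[f|mZ]|mM]|mX]) :
    ∫ ω, ((μ[μ[f|mZ]|mX]) ω - (μ[f|mK]) ω) ^ 2 ∂μ ≤
      ∫ ω, ((μ[μ[f|mZ]|mM]) ω - (μ[f|mK]) ω) ^ 2 ∂μ := by
  have h1 : μ[fun ω => (μ[μ[f|mZ]|mM]) ω - (μ[f|mK]) ω | mX] =ᵐ[μ]
      fun ω => (μ[μ[f|mZ]|mX]) ω - (μ[f|mK]) ω :=
    (condExp_sub_condExp_of_le hKX hX integrable_condExp f).trans (hMarkov.symm.sub EventuallyEq.rfl)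
  rw [← integral_sq_congr_ae h1]
  refine integral_condExp_sq_le_of_ae_bdd
    (integrable_condExp.aestronglyMeasurable.sub integrable_condExp.aestronglyMeasurable)
    (ae_abs_sub_le_add (M := M) (M' := M) ?_ ?_)
  · exact ae_bdd_abs_condExp_of_ae_bdd_abs (ae_bdd_abs_condExp_of_ae_bdd_abs hb)
  · exact ae_bdd_abs_condExp_of_ae_bdd_abs hb

end Abstract

/-! ### Slabs and far sets on the discrete torus, in offset coordinates -/

section Slabs

/-- **An `R`-slab at an integer offset, in offset coordinates**: for `c + R ≤ L` and
`t ∈ ℤ/Lℤ`, `(t - c).val < R ↔ c ≤ t.val < c + R` (no wrap-around). [folklore] -/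
theorem val_sub_natCast_lt_iff {L : ℕ} [NeZero L] (t : ZMod L) {c R : ℕ} (hcR : c + R ≤ L) :
    (t - (c : ZMod L)).val < R ↔ c ≤ t.val ∧ t.val < c + R := by
  have ht : ((t.val : ℕ) : ZMod L) = t := ZMod.natCast_zmod_val t
  have hτ : t.val < L := ZMod.val_lt t
  rcases Nat.lt_or_ge t.val c with h | h
  · have hk : t - (c : ZMod L) = ((t.val + (L - c) : ℕ) : ZMod L) := by
      rw [Nat.cast_add, Nat.cast_sub (by omega : c ≤ L), ZMod.natCast_self, zero_sub, ht]
      ring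
    rw [hk, ZMod.val_cast_of_lt (by omega : t.val + (L - c) < L)]
    omega
  · have hk : t - (c : ZMod L) = ((t.val - c : ℕ) : ZMod L) := by
      rw [Nat.cast_sub h, ht]
    rw [hk, ZMod.val_cast_of_lt (by omega : t.val - c < L)]
    omega

/-- **The far set of a slab contains everything `2R` above it** (interval side, `R ≤ c`: no
wrap-around below): `c + 2R ≤ t.val → 3R ≤ (t - c + R).val`. [folklore] -/
theorem le_val_sub_natCast_add {L : ℕ} [NeZero L] (t : ZMod L) {c R : ℕ} (hRc : R ≤ c)
    (h : c + 2 * R ≤ t.val) : 3 * R ≤ (t - (c : ZMod L) + (R : ZMod L)).val := by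
  have ht : ((t.val : ℕ) : ZMod L) = t := ZMod.natCast_zmod_val t
  have hτ : t.val < L := ZMod.val_lt t
  have hk : t - (c : ZMod L) + (R : ZMod L) = ((t.val - c + R : ℕ) : ZMod L) := by
    rw [Nat.cast_add, Nat.cast_sub (by omega : c ≤ t.val), ht]
  rw [hk, ZMod.val_cast_of_lt (by omega : t.val - c + R < L)]
  omega

/-- **The antipodal slab of a ring lies in the far set** (`2R ≤ S`, side `2S+1`):
`(t - b - S).val < R → 3R ≤ (t - b + R).val`. [folklore] -/
theorem le_val_sub_add_of_antipodal (S R : ℕ) (hRS : 2 * R ≤ S) (t b : ZMod (2 * S + 1))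
    (h : (t - b - (S : ZMod (2 * S + 1))).val < R) :
    3 * R ≤ (t - b + (R : ZMod (2 * S + 1))).val := by
  set s := t - b - (S : ZMod (2 * S + 1)) with hs
  have hsv : ((s.val : ℕ) : ZMod (2 * S + 1)) = s := ZMod.natCast_zmod_val s
  have hk : t - b + (R : ZMod (2 * S + 1)) = ((s.val + S + R : ℕ) : ZMod (2 * S + 1)) := by
    rw [Nat.cast_add, Nat.cast_add, hsv, hs]
    ring
  rw [hk, ZMod.val_cast_of_lt (by omega : s.val + S + R < 2 * S + 1)]
  omega

end Slabs

end BoxDecoup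

/-! ### The registered stub -/

/-- `stub_boxDecoupling_of_hmc` — **hierarchical maximal correlation ⟹ box decoupling**
(stub (C2) of the line `maxcorr-halving`). Let `μ = wilsonMeasure r.ρ β` on `(ℤ/(2S+1))⁴`,
`P_D := μ[· | cylinderEvents D]`, `Q = Q(a, n)` a cylinder with exterior links `K`. HYPOTHESIS
(H): there are `R ≥ 1`, `0 ≤ ρ < 1` such that for every cylinder, direction `i` and offset `c`
(`c + R ≤ n i` on an interval side) the `R`-slab `X` at offset `c` and its far set `Z` (links of
`Q` at torus distance `≥ R` from the slab) satisfy `‖P_{K∪X} P_{K∪Z} f − P_K f‖₂ ≤ ρ ‖f − P_K f‖₂`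
for all bounded measurable `f`. CONCLUSION, with the same `R, ρ`: (ring) on a ring side with
`2R ≤ S`, two antipodal `R`-slabs satisfy the same bound — an instance of (H) at
`c = (b − a i).val` (the antipodal slab lies in the far set, `BoxDecoup.le_val_sub_add_of_antipodal`)
and monotonicity of the bound in `Z` (`maxCorr_sq_le_of_mono`); (corridor) on an interval side,
`X = {offset < c}` (`c ≥ R`) and `Z = {offset ≥ c + mR}` satisfy it with `ρ^{⌊m/2⌋}` — chain the
odd slabs `S_l = [c + 2lR, c + 2lR + R)`, `l < ⌊m/2⌋`: by the Markov property of `μ`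
(`condExp_wilsonMeasure_markov_slab`) `P_{K∪S_l} P_{K∪Z} = P_{K∪S_l} P_{K∪S_{l+1}} P_{K∪Z}`, so
`‖P_{K∪S_l}P_{K∪Z} f − P_K f‖ ≤ ρ ‖P_{K∪S_{l+1}}P_{K∪Z} f − P_K f‖` by (H) at `S_l`
(`S_{l+1} ⊆ far(S_l)`, `BoxDecoup.sq_le_of_markov_step`), the last slab gives `ρ ‖f − P_K f‖`
(`Z ⊆ far`), and `P_{K∪X}` in front is a contraction (`BoxDecoup.sq_le_of_markov_first`);
`⌊m/2⌋ = 0` or `Z = ∅` is the plain contraction `maxCorr_sq_le_of_coarse`. Martinelli 1999 §3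
(block factorisation of conditional variances); Georgii 2011 Rem. 1.24. [folklore] -/
theorem stub_boxDecoupling_of_hmc :
    ∀ (G : Type) [Group G] [TopologicalSpace G] [IsTopologicalGroup G] [CompactSpace G]
      [MeasurableSpace G] [BorelSpace G] (r : LatticeRep G) (β : ℝ),
      (∃ R : ℕ, 1 ≤ R ∧ ∃ ρ : ℝ, 0 ≤ ρ ∧ ρ < 1 ∧ ∀ (S : ℕ) (μW : Measure (GaugeConfig 4 (2 * S + 1) G)),
        μW = (wilsonMeasure r.ρ β : Measure (GaugeConfig 4 (2 * S + 1) G)) →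
        ∀ (a : Fin 4 → ZMod (2 * S + 1)) (n : Fin 4 → ℕ), (∀ ν, n ν ≤ 2 * S + 1) →
        ∀ (Q : Set (Site 4 (2 * S + 1))), Q = {x | ∀ ν, (x ν - a ν).val < n ν} →
        ∀ (K : Set (Edge 4 (2 * S + 1))), K = {ℓ | ℓ.1 ∉ Q} →
        ∀ (i : Fin 4) (c : ℕ), (n i ≤ 2 * S → c + R ≤ n i) →
        ∀ (X : Set (Edge 4 (2 * S + 1))), X = {ℓ | ℓ.1 ∈ Q ∧ (ℓ.1 i - a i - (c : ZMod (2 * S + 1))).val < R} →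
        ∀ (Z : Set (Edge 4 (2 * S + 1))),
          Z = {ℓ | ℓ.1 ∈ Q ∧ 3 * R ≤ (ℓ.1 i - a i - (c : ZMod (2 * S + 1)) + (R : ZMod (2 * S + 1))).val} →
        ∀ f : GaugeConfig 4 (2 * S + 1) G → ℝ, Measurable f → (∃ M : ℝ, ∀ U, |f U| ≤ M) →
        ∫ U, (condExp (cylinderEvents (K ∪ X)) μW (condExp (cylinderEvents (K ∪ Z)) μW f) U
            - condExp (cylinderEvents K) μW f U) ^ 2 ∂μW ≤
          ρ ^ 2 * ∫ U, (f U - condExp (cylinderEvents K) μW f U) ^ 2 ∂μW) →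
      ∃ R : ℕ, 1 ≤ R ∧ ∃ ρ : ℝ, 0 ≤ ρ ∧ ρ < 1 ∧ ∀ (S : ℕ) (μW : Measure (GaugeConfig 4 (2 * S + 1) G)),
        μW = (wilsonMeasure r.ρ β : Measure (GaugeConfig 4 (2 * S + 1) G)) →
        ∀ (a : Fin 4 → ZMod (2 * S + 1)) (n : Fin 4 → ℕ), (∀ ν, n ν ≤ 2 * S + 1) →
        ∀ (Q : Set (Site 4 (2 * S + 1))), Q = {x | ∀ ν, (x ν - a ν).val < n ν} →
        ∀ (K : Set (Edge 4 (2 * S + 1))), K = {ℓ | ℓ.1 ∉ Q} →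
        ∀ (i : Fin 4),
        (n i = 2 * S + 1 → 2 * R ≤ S → ∀ (b : ZMod (2 * S + 1)) (X Z : Set (Edge 4 (2 * S + 1))),
          X = {ℓ | ℓ.1 ∈ Q ∧ (ℓ.1 i - b).val < R} →
          Z = {ℓ | ℓ.1 ∈ Q ∧ (ℓ.1 i - b - (S : ZMod (2 * S + 1))).val < R} →
          ∀ f : GaugeConfig 4 (2 * S + 1) G → ℝ, Measurable f → (∃ M : ℝ, ∀ U, |f U| ≤ M) →
          ∫ U, (condExp (cylinderEvents (K ∪ X)) μW (condExp (cylinderEvents (K ∪ Z)) μW f) U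
              - condExp (cylinderEvents K) μW f U) ^ 2 ∂μW ≤
            ρ ^ 2 * ∫ U, (f U - condExp (cylinderEvents K) μW f U) ^ 2 ∂μW) ∧
        (n i ≤ 2 * S → ∀ (c m : ℕ), R ≤ c → ∀ (X Z : Set (Edge 4 (2 * S + 1))),
          X = {ℓ | ℓ.1 ∈ Q ∧ (ℓ.1 i - a i).val < c} →
          Z = {ℓ | ℓ.1 ∈ Q ∧ c + m * R ≤ (ℓ.1 i - a i).val} →
          ∀ f : GaugeConfig 4 (2 * S + 1) G → ℝ, Measurable f → (∃ M : ℝ, ∀ U, |f U| ≤ M) →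
          ∫ U, (condExp (cylinderEvents (K ∪ X)) μW (condExp (cylinderEvents (K ∪ Z)) μW f) U
              - condExp (cylinderEvents K) μW f U) ^ 2 ∂μW ≤
            (ρ ^ (m / 2)) ^ 2 * ∫ U, (f U - condExp (cylinderEvents K) μW f U) ^ 2 ∂μW) := by
  intro G _ _ _ _ _ _ r β hHMC
  obtain ⟨R, hR, ρ, hρ0, hρ1, H⟩ := hHMC
  refine ⟨R, hR, ρ, hρ0, hρ1, fun S μW hμ a n hn Q hQ K hK i => ⟨?_, ?_⟩⟩
  · -- ring clause: an instance of (H) at the offset `c = (b - a i).val`, then monotonicity in `Z`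
    intro hni hRS b X Z hX hZ f hf hbd
    obtain ⟨M, hM⟩ := hbd
    haveI : IsProbabilityMeasure μW :=
      hμ ▸ isProbabilityMeasure_wilsonMeasure (d := 4) (L := 2 * S + 1) r.ρ r.continuous β
    have hcz : (((b - a i).val : ℕ) : ZMod (2 * S + 1)) = b - a i := ZMod.natCast_zmod_val _
    have hXeq : X = {ℓ : Edge 4 (2 * S + 1) | ℓ.1 ∈ Q ∧
        (ℓ.1 i - a i - (((b - a i).val : ℕ) : ZMod (2 * S + 1))).val < R} := by
      rw [hX, hcz]
      simp only [sub_sub_sub_cancel_right]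
    have hZsub : K ∪ Z ⊆ K ∪ {ℓ : Edge 4 (2 * S + 1) | ℓ.1 ∈ Q ∧ 3 * R ≤ (ℓ.1 i - a i -
        (((b - a i).val : ℕ) : ZMod (2 * S + 1)) + (R : ZMod (2 * S + 1))).val} := by
      refine Set.union_subset_union_right K ?_
      rw [hZ, hcz]
      rintro ℓ ⟨hQℓ, hℓ⟩
      refine ⟨hQℓ, ?_⟩
      rw [sub_sub_sub_cancel_right]
      exact BoxDecoup.le_val_sub_add_of_antipodal S R hRS _ b hℓ
    have Hc := H S μW hμ a n hn Q hQ K hK i (b - a i).val (fun h => absurd h (by omega)) _ hXeq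
      _ rfl
    exact maxCorr_sq_le_of_mono cylinderEvents_le_pi cylinderEvents_le_pi cylinderEvents_le_pi
      cylinderEvents_le_pi (cylinderEvents_mono Set.subset_union_left) le_rfl
      (cylinderEvents_mono Set.subset_union_left) (cylinderEvents_mono hZsub) Hc
      hf.aestronglyMeasurable (ae_of_all _ hM)
  · -- corridor clause
    intro hni c m hc X Z hX hZ f hf hbd
    obtain ⟨M, hM⟩ := hbd
    haveI : IsProbabilityMeasure μW :=
      hμ ▸ isProbabilityMeasure_wilsonMeasure (d := 4) (L := 2 * S + 1) r.ρ r.continuous β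
    have hKle : ∀ A : Set (Edge 4 (2 * S + 1)),
        (cylinderEvents K : MeasurableSpace (GaugeConfig 4 (2 * S + 1) G)) ≤
          cylinderEvents (K ∪ A) := fun A => cylinderEvents_mono Set.subset_union_left
    -- the `R`-slabs of `Q` in offset coordinates
    set Slab : ℕ → Set (Edge 4 (2 * S + 1)) := fun q =>
      {ℓ | ℓ.1 ∈ Q ∧ q ≤ (ℓ.1 i - a i).val ∧ (ℓ.1 i - a i).val < q + R} with hSlab
    -- (H) at an interior slab, in monotone and a.e. form
    have key : ∀ q : ℕ, R ≤ q → q + R ≤ n i → ∀ Z' : Set (Edge 4 (2 * S + 1)),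
        Z' ⊆ {ℓ | ℓ.1 ∈ Q ∧ q + 2 * R ≤ (ℓ.1 i - a i).val} →
        ∀ h : GaugeConfig 4 (2 * S + 1) G → ℝ, AEStronglyMeasurable h μW → ∀ M' : ℝ,
        (∀ᵐ U ∂μW, |h U| ≤ M') →
        ∫ U, ((μW[μW[h | cylinderEvents (K ∪ Z')] | cylinderEvents (K ∪ Slab q)]) U -
            (μW[h | cylinderEvents K]) U) ^ 2 ∂μW ≤
          ρ ^ 2 * ∫ U, (h U - (μW[h | cylinderEvents K]) U) ^ 2 ∂μW := by
      intro q hRq hqn Z' hZ' h hh M' hhb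
      have hXeq : Slab q = {ℓ : Edge 4 (2 * S + 1) | ℓ.1 ∈ Q ∧
          (ℓ.1 i - a i - (q : ZMod (2 * S + 1))).val < R} := by
        ext ℓ
        simp only [hSlab, Set.mem_setOf_eq,
          BoxDecoup.val_sub_natCast_lt_iff _ (by omega : q + R ≤ 2 * S + 1)]
      have hZ'sub : K ∪ Z' ⊆ K ∪ {ℓ : Edge 4 (2 * S + 1) | ℓ.1 ∈ Q ∧ 3 * R ≤
          (ℓ.1 i - a i - (q : ZMod (2 * S + 1)) + (R : ZMod (2 * S + 1))).val} :=
        Set.union_subset_union_right K fun ℓ hℓ =>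
          ⟨(hZ' hℓ).1, BoxDecoup.le_val_sub_natCast_add _ hRq (hZ' hℓ).2⟩
      have Hc := H S μW hμ a n hn Q hQ K hK i q (fun _ => hqn) _ hXeq _ rfl
      exact maxCorr_sq_le_of_mono cylinderEvents_le_pi cylinderEvents_le_pi cylinderEvents_le_pi
        cylinderEvents_le_pi (hKle _) le_rfl (hKle _) (cylinderEvents_mono hZ'sub) Hc hh hhb
    by_cases htriv : m / 2 = 0 ∨ n i ≤ c + m * R
    · -- no corridor to cross: the plain contraction bound (or an empty far side)
      have h1 : ∫ U, ((μW[μW[f | cylinderEvents (K ∪ Z)] | cylinderEvents (K ∪ X)]) U -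
          (μW[f | cylinderEvents K]) U) ^ 2 ∂μW ≤
          ∫ U, (f U - (μW[f | cylinderEvents K]) U) ^ 2 ∂μW :=
        maxCorr_sq_le_of_coarse cylinderEvents_le_pi cylinderEvents_le_pi (hKle _) (hKle _)
          hf.aestronglyMeasurable (ae_of_all _ hM)
      rcases htriv with h0 | hempty
      · rw [h0, pow_zero, one_pow, one_mul]
        exact h1
      · have hZe : Z = ∅ := by
          rw [hZ]
          ext ℓ
          simp only [Set.mem_setOf_eq, Set.mem_empty_iff_false, iff_false, not_and, not_le]
          intro hQℓ
          rw [hQ, Set.mem_setOf_eq] at hQℓ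
          exact (hQℓ i).trans_le hempty
        rw [hZe, Set.union_empty, maxCorr_sq_eq_zero_of_coarse cylinderEvents_le_pi (hKle X) f]
        positivity
    · rw [not_or, not_le] at htriv
      obtain ⟨hj0, hcm⟩ := htriv
      set j := m / 2 with hj
      have h2j : 2 * j ≤ m := Nat.mul_div_le m 2
      have hsucc : ∀ l : ℕ, (l + 1) * (2 * R) = l * (2 * R) + 2 * R := fun l => by ring
      have hA1 : ∀ l : ℕ, l + 1 ≤ j → c + l * (2 * R) + 2 * R ≤ c + m * R :=
        fun l hl => by nlinarith
      have hZ_sub : ∀ l : ℕ, l + 1 ≤ j →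
          Z ⊆ {ℓ | ℓ.1 ∈ Q ∧ c + l * (2 * R) + 2 * R ≤ (ℓ.1 i - a i).val} := by
        intro l hl ℓ hℓ
        rw [hZ, Set.mem_setOf_eq] at hℓ
        exact ⟨hℓ.1, (hA1 l hl).trans hℓ.2⟩
      -- the chain of slabs: level `k` is the slab at offset `c + l (2R)` with `k + l + 1 = j`
      have chain : ∀ k l : ℕ, k + l + 1 = j → ∀ h : GaugeConfig 4 (2 * S + 1) G → ℝ,
          AEStronglyMeasurable h μW → ∀ M' : ℝ, (∀ᵐ U ∂μW, |h U| ≤ M') →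
          ∫ U, ((μW[μW[h | cylinderEvents (K ∪ Z)] |
              cylinderEvents (K ∪ Slab (c + l * (2 * R)))]) U -
              (μW[h | cylinderEvents K]) U) ^ 2 ∂μW ≤
            (ρ ^ (k + 1)) ^ 2 * ∫ U, (h U - (μW[h | cylinderEvents K]) U) ^ 2 ∂μW := by
        intro k
        induction k with
        | zero =>
          intro l hl h hh M' hhb
          rw [zero_add, pow_one]
          have hl' := hA1 l (by omega)
          exact key (c + l * (2 * R)) (by omega) (by omega) Z (hZ_sub l (by omega)) h hh M' hhb
        | succ k ih =>
          intro l hl h hh M' hhb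
          have hl2 := hA1 (l + 1) (by omega)
          have hs := hsucc l
          have hMarkov := condExp_wilsonMeasure_markov_slab r β S μW hμ a n i hni
            (c + (l + 1) * (2 * R)) R hR Q hQ K hK (Slab (c + (l + 1) * (2 * R))) rfl
            (B := Z) (D := Slab (c + l * (2 * R)))
            (fun ℓ hℓ => by
              rw [hZ, Set.mem_setOf_eq] at hℓ
              exact ⟨hℓ.1, by omega⟩)
            (fun ℓ hℓ _ => by
              simp only [hSlab, Set.mem_setOf_eq] at hℓ
              omega)
            hhb
          have step := BoxDecoup.sq_le_of_markov_step cylinderEvents_le_pi cylinderEvents_le_pi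
            (hKle _) (hKle _)
            (key (c + l * (2 * R)) (by omega) (by omega) (Slab (c + (l + 1) * (2 * R)))
              (fun ℓ hℓ => by
                simp only [hSlab, Set.mem_setOf_eq] at hℓ
                exact ⟨hℓ.1, by omega⟩))
            hhb hMarkov
          refine step.trans ?_
          have hih := ih (l + 1) (by omega) h hh M' hhb
          calc ρ ^ 2 * ∫ U, ((μW[μW[h | cylinderEvents (K ∪ Z)] |
                cylinderEvents (K ∪ Slab (c + (l + 1) * (2 * R)))]) U -
                (μW[h | cylinderEvents K]) U) ^ 2 ∂μW
              ≤ ρ ^ 2 * ((ρ ^ (k + 1)) ^ 2 *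
                  ∫ U, (h U - (μW[h | cylinderEvents K]) U) ^ 2 ∂μW) :=
                mul_le_mul_of_nonneg_left hih (sq_nonneg ρ)
            _ = (ρ ^ (k + 1 + 1)) ^ 2 * ∫ U, (h U - (μW[h | cylinderEvents K]) U) ^ 2 ∂μW := by
                ring
      -- the first factor `P_{K ∪ X}` is a contraction after crossing the lowest slab
      have hmR : R ≤ m * R := Nat.le_mul_of_pos_left R (by omega)
      have hMarkov0 := condExp_wilsonMeasure_markov_slab r β S μW hμ a n i hni c R hR Q hQ K hK
        (Slab c) rfl (B := Z) (D := X)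
        (fun ℓ hℓ => by
          rw [hZ, Set.mem_setOf_eq] at hℓ
          exact ⟨hℓ.1, by omega⟩)
        (fun ℓ hℓ _ => by
          rw [hX, Set.mem_setOf_eq] at hℓ
          omega)
        (ae_of_all _ hM)
      have first := BoxDecoup.sq_le_of_markov_first cylinderEvents_le_pi (hKle X) (ae_of_all _ hM)
        hMarkov0
      have last := chain (j - 1) 0 (by omega) f hf.aestronglyMeasurable M (ae_of_all _ hM)
      rw [zero_mul, add_zero, Nat.sub_add_cancel (Nat.one_le_iff_ne_zero.2 hj0)] at last
      exact first.trans last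

end Summit.QuantumFields.YangMills.Theorems.SusceptibilityToPoincare

end
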